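import Literature.NumberTheory.DiophantineGeometry.GenusTwoTwoTorsionS5bProofs
import Literature.NumberTheory.DiophantineGeometry.AVTorsionCharpolyReductionProofs
import Literature.NumberTheory.FaltingsSerre.ResidualFrobeniusData
import Literature.NumberTheory.FaltingsSerre.ParamodularBridge
import HarnessLib

/-!
# Venture ResidMod — the MOD-2 flag from EULER FACTORS: in a Weierstrass frame of `A[2]`, a good odd
# prime `q` with `a_q, b_q` odd gives a Galois element acting by a `5`-cycle, and one with `a_q` odd,
# `b_q` even gives an element of order `3` or `6`

HONEST FRAMING. Interface file of a COMPUTATION cell (`pub-residmod`); companion of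
`Mod2A5bCertificate.lean` (the consumer of Boxer–Calegari–Gee–Pilloni 2025, Thm. 8.3.2, whose
hypotheses `h5` / `h36` — "some `g` acts on the five non-rational Weierstrass points by a `5`-cycle /
by an element of order `3` or `6`" — this file DERIVES in the kernel from Euler-factor data). NO surface
is claimed modular and NO Euler factor is computed here: the Euler factor `L_q(A,T) = 1 − aT + bT² −
qaT³ + q²T⁴` enters as the binder `A.HasGoodEulerFactorAt q …` (the tree's predicate of the paramodular
cell, [BPPTVY (4.1.5)]), exactly the datum the cell's engines certify by exact point counts
`#X(𝔽_q), #X(𝔽_{q²})`; the Weierstrass frame (`e`, `perm`, `he`) is the modelling binder of the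
companion file; `hframe` says "`r` is the matrix form of `V₂(A)` in the basis `c`" (any basis).

THE CHAIN (all in the kernel, standard axioms):
`L_q(A,T)` ⟹ (definition of `HasGoodEulerFactorAt`, at `ℓ = 2 ≠ q`) the arithmetic Frobenius `σ` at
`q` has `det(X − σ | V₂A) = X⁴L_q(1/X)` ⟹ (Serre–Tate, `T₂A/2 = A[2]`: the tree's
`exists_charpoly_toMatrix_rationalTateRep_eq_map_and_map_eq_charpoly_torsionFrame`) the matrix of `σ`
on `A[2]` in the frame `e` has characteristic polynomial `X⁴L_q(1/X) mod 2 = X⁴ + āX³ + b̄X² + āX + 1`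
(`map_reverse_lPolynomialOfSurface_mod_two`) ⟹ for `a, b` odd this is `Φ₅`, so (Cayley–Hamilton)
`M⁵ = 1 ≠ M` for `M = s5bMatrix (perm σ)`; for `a` odd, `b` even it is `X⁴ + X³ + X + 1 =
(X+1)²(X²+X+1)`, so `M⁶ = 1` and `M² ≠ 1` (trace argument) ⟹ since `σ ↦ s5bMatrix σ` is
multiplicative and faithful (tree: `s5bMatrix_mul`, `eq_one_of_s5bMatrix_eq_one`,
`GenusTwoTwoTorsionS5bProofs.lean`), the PERMUTATION `perm σ` satisfies `(perm σ)⁵ = 1 ≠ perm σ`, resp.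
`(perm σ)⁶ = 1 ≠ (perm σ)²`.  In `S₅(b)` terms (BCGP 2025 §8.1: `A[2] = 𝔽₂⁵/⟨(1,…,1)⟩` as an
`S₅(b)`-module): the characteristic polynomial of `σ ∈ S₅` on this module is `∏(X^{ℓᵢ} − 1)/(X − 1)`
over the cycle lengths `ℓᵢ`, i.e. `Φ₅` for a `5`-cycle, `(X+1)²(X²+X+1)` for cycle types `(3)` and
`(3,2)`, and `(X+1)⁴` for all `2`-power elements — so `(a_q, b_q) mod 2` reads off exactly the
"Frobenius of order `5`" / "of order divisible by `3`" data of the cell's decision rule GAL5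
(PLAN A3(b)), with no Galois-group computation.

References: [BoxerCalegariGeePilloni2025] arXiv:2502.20645 §8.1, Thm. 8.3.2; [BrumerEtAl2019]
ANT 13 (2019) (4.1.5) p. 1164 (Euler factor shape), Lemma 5.1.5 p. 1173 (orders from `Q_p mod 2`);
[SerreTate1968] §1 (`T_ℓ/ℓ = A[ℓ]`).
-/

noncomputable section

namespace Summit.Ventures.ResidMod

open Equiv Matrix Polynomial Field IsDedekindDomain
open scoped NumberField
open Literature.NumberTheory.GaloisRepresentations Literature.NumberTheory.FaltingsSerre
open Literature.NumberTheory.DiophantineGeometry Literature.NumberTheory.Automorphic.Paramodular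
open Literature.AlgebraicGeometry.Motives (AbelianVariety)

/-! ## A. Two Cayley–Hamilton facts over `𝔽₂` -/

/-- A `4 × 4` matrix over `𝔽₂` with characteristic polynomial `Φ₅ = X⁴+X³+X²+X+1` satisfies `M⁵ = 1`
and `M ≠ 1` (Cayley–Hamilton; `Φ₅(1) = 5 = 1 ≠ 0`). Matrix version of the tree's
`GSp4F2.pow_five_eq_one_of_charpoly`. [cite: BrumerEtAl2019, Lemma 5.1.5 p. 1173] -/
theorem pow_five_eq_one_of_charpoly_eq {M : Matrix (Fin 4) (Fin 4) (ZMod 2)}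
    (h : M.charpoly = X ^ 4 + X ^ 3 + X ^ 2 + X + 1) : M ^ 5 = 1 ∧ M ≠ 1 := by
  have hCH := Matrix.aeval_self_charpoly M
  rw [h] at hCH
  simp only [map_add, map_pow, aeval_X, map_one] at hCH
  refine ⟨?_, ?_⟩
  · have e : aeval M ((X - 1) * (X ^ 4 + X ^ 3 + X ^ 2 + X + 1) : (ZMod 2)[X]) = M ^ 5 - 1 := by
      rw [show ((X - 1) * (X ^ 4 + X ^ 3 + X ^ 2 + X + 1) : (ZMod 2)[X]) = X ^ 5 - 1 by ring]
      simp only [map_sub, map_pow, aeval_X, map_one]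
    rw [map_mul, show aeval M (X ^ 4 + X ^ 3 + X ^ 2 + X + 1 : (ZMod 2)[X]) =
      M ^ 4 + M ^ 3 + M ^ 2 + M + 1 by simp only [map_add, map_pow, aeval_X, map_one], hCH,
      mul_zero] at e
    exact sub_eq_zero.1 e.symm
  · intro h1
    rw [h1] at hCH
    simp only [one_pow] at hCH
    have h00 := congrFun (congrFun hCH 0) 0
    revert h00
    simp only [Matrix.add_apply, Matrix.one_apply_eq, Matrix.zero_apply]
    decide

/-- A `4 × 4` matrix over `𝔽₂` with characteristic polynomial `X⁴+X³+X+1 = (X+1)²(X²+X+1)` satisfies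
`M⁶ = 1` (Cayley–Hamilton: `(X²+X+1)(X⁴+X³+X+1) = X⁶+1`) and `M² ≠ 1` (else `M+1` is nilpotent, so
`tr M = tr 1 = 0`, while the characteristic polynomial gives `tr M = 1`). [folklore] -/
theorem pow_six_eq_one_of_charpoly_eq {M : Matrix (Fin 4) (Fin 4) (ZMod 2)}
    (h : M.charpoly = X ^ 4 + X ^ 3 + X + 1) : M ^ 6 = 1 ∧ M ^ 2 ≠ 1 := by
  have hCH := Matrix.aeval_self_charpoly M
  rw [h] at hCH
  refine ⟨?_, ?_⟩
  · have h2 : (2 : (ZMod 2)[X]) = 0 := by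
      have := CharP.cast_eq_zero (ZMod 2)[X] 2
      simpa using this
    have e : aeval M ((X ^ 2 + X + 1) * (X ^ 4 + X ^ 3 + X + 1) : (ZMod 2)[X]) = M ^ 6 - 1 := by
      rw [show ((X ^ 2 + X + 1) * (X ^ 4 + X ^ 3 + X + 1) : (ZMod 2)[X]) =
        X ^ 6 - 1 + 2 * (X ^ 5 + X ^ 4 + X ^ 3 + X ^ 2 + X + 1) by ring, h2, zero_mul, add_zero]
      simp only [map_sub, map_pow, aeval_X, map_one]
    rw [map_mul, hCH, mul_zero] at e
    exact sub_eq_zero.1 e.symm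
  · intro h2
    -- trace from the characteristic polynomial: `tr M = -coeff₃ = 1`
    have hc3 : (X ^ 4 + X ^ 3 + X + 1 : (ZMod 2)[X]).coeff 3 = 1 := by
      simp [coeff_X, coeff_one]
    have htr : M.trace = 1 := by
      rw [Matrix.trace_eq_neg_charpoly_coeff, h, Fintype.card_fin, show 4 - 1 = 3 from rfl, hc3]
      decide
    -- `N = M + 1` squares to `0` (`M² = 1`, characteristic `2`), so its trace vanishes
    have hxx : ∀ x y : ZMod 2, x + y + (y + x) = 0 := by decide
    have hN : (M + 1) * (M + 1) = 0 := by
      rw [add_mul, mul_add, mul_add, mul_one, one_mul, one_mul, ← pow_two, h2]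
      ext i j
      simp only [Matrix.add_apply, Matrix.zero_apply]
      exact hxx _ _
    have hnil : IsNilpotent (M + 1) := ⟨2, by rw [pow_two, hN]⟩
    have htr0 : (M + 1).trace = 0 := (Matrix.isNilpotent_trace_of_isNilpotent hnil).eq_zero
    rw [Matrix.trace_add, htr, Matrix.trace_one, Fintype.card_fin] at htr0
    revert htr0
    decide

/-! ## B. Powers of `s5bMatrix` -/

/-- `σ ↦ s5bMatrix σ` is multiplicative (tree: `s5bMatrix_mul`), hence compatible with powers.
[cite: BoxerCalegariGeePilloni2025, §8.1] -/
theorem s5bMatrix_pow (σ : Perm (Fin 5)) (n : ℕ) : s5bMatrix (σ ^ n) = s5bMatrix σ ^ n := by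
  induction n with
  | zero => rw [pow_zero, pow_zero, s5bMatrix_one]
  | succ n ih => rw [pow_succ, pow_succ, s5bMatrix_mul, ih]

section Frame

variable {A : AbelianVariety ℚ} {e : A.geomTorsion (2 : ℕ) ≃+ (Fin 4 → ZMod 2)}
  {perm : absoluteGaloisGroup ℚ →* Perm (Fin 5)}

/-! ## C. The residual characteristic polynomial of a Frobenius from the Euler factor -/

/-- **`det(X − Frob_q | A[2]) = X⁴L_q(1/X) mod 2` in the Weierstrass frame.**  If `L_q(A,T) =
1 − aT + bT² − qaT³ + q²T⁴` is the good Euler factor of the surface `A` at an odd prime `q`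
(`HasGoodEulerFactorAt`), `r` is the matrix form of `V₂(A)` in a basis `c` (`hframe`), and `σ` is an
arithmetic Frobenius at a prime of `ℚ̄` over `q`, then the matrix `s5bMatrix (perm σ)` of `σ` on `A[2]`
has characteristic polynomial `X⁴ + āX³ + b̄X² + āX + 1`. [cite: SerreTate1968, §1] [cite: BrumerEtAl2019, (4.1.5) p. 1164 and (5.2.3) p. 1175] -/
theorem charpoly_s5bMatrix_perm_frob (hA : A.dim = 2)
    (he : ∀ (g : absoluteGaloisGroup ℚ) (P : A.geomTorsion (2 : ℕ)), e (g • P) = s5bMatrix (perm g) *ᵥ e P)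
    {c : Module.Basis (Fin 4) ℚ_[2] (A.rationalTateModule 2)} {r : FramedGaloisRep ℚ ℚ_[2] 4}
    (hframe : A.IsFrameOfTateRep 2 c r) {q : ℕ} (hq2 : q ≠ 2) (hqodd : Odd q) {a b : ℤ}
    (hL : A.HasGoodEulerFactorAt q ((lPolynomialOfSurface q a b).map (Int.castRingHom ℚ)))
    {v : HeightOneSpectrum (𝓞 ℚ)} (hv : ((q : ℕ) : 𝓞 ℚ) ∈ v.asIdeal) {𝔓}
    (h𝔓 : 𝔓 ∈ v.primesAbove) {σ : absoluteGaloisGroup ℚ} (hσ : IsArithFrobAt (𝓞 ℚ) σ 𝔓) :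
    (s5bMatrix (perm σ)).charpoly =
      X ^ 4 + C ((a : ℤ) : ZMod 2) * X ^ 3 + C ((b : ℤ) : ZMod 2) * X ^ 2 + C ((a : ℤ) : ZMod 2) * X + 1 := by
  -- the `2`-adic Frobenius polynomial from the Euler factor
  have hF := (hL 2 (Ne.symm hq2) c r hframe v hv).2 𝔓 h𝔓 σ hσ
  -- `FramedRep.charpoly r σ = det(X − [σ]_c)`
  have hr : FramedRep.charpoly r σ = (LinearMap.toMatrix c c (A.rationalTateRep 2 σ)).charpoly := by
    rw [FramedRep.charpoly, hframe σ]
  -- Serre–Tate: an integral polynomial reducing to the torsion charpoly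
  obtain ⟨P, hP, hPbar⟩ :=
    A.exists_charpoly_toMatrix_rationalTateRep_eq_map_and_map_eq_charpoly_torsionFrame 2
      (by norm_num) (by rw [hA]) e (fun g => s5bMatrix (perm g)) he c σ
  -- identify `P` with `X⁴L_q(1/X) ∈ ℤ₂[X]`
  have key : P = (lPolynomialOfSurface q a b).reverse.map (Int.castRingHom ℤ_[2]) := by
    apply Polynomial.map_injective (algebraMap ℤ_[2] ℚ_[2]) (IsFractionRing.injective ℤ_[2] ℚ_[2])
    rw [hP, ← hr, hF, reverse_map_of_injective _ (Int.castRingHom ℚ).injective_int,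
      map_map_intCast (Int.castRingHom ℚ) (algebraMap ℚ ℚ_[2])
        ((algebraMap ℤ_[2] ℚ_[2]).comp (Int.castRingHom ℤ_[2])),
      ← Polynomial.map_map]
  rw [← hPbar, key, map_reverse_lPolynomialOfSurface_mod_two hqodd]

/-- **GAL5, the `5`-cycle, from an Euler factor**: `a_q`, `b_q` odd at a good odd prime `q` ⟹ some
`σ ∈ Γ_ℚ` (a Frobenius at `q`) acts on the five non-rational Weierstrass points by a `5`-cycle:
`(perm σ)⁵ = 1`, `perm σ ≠ 1`. [cite: BrumerEtAl2019, Lemma 5.1.5 p. 1173] [cite: BoxerCalegariGeePilloni2025, §8.1] -/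
theorem exists_perm_pow_five_of_eulerData (hA : A.dim = 2)
    (he : ∀ (g : absoluteGaloisGroup ℚ) (P : A.geomTorsion (2 : ℕ)), e (g • P) = s5bMatrix (perm g) *ᵥ e P)
    {c : Module.Basis (Fin 4) ℚ_[2] (A.rationalTateModule 2)} {r : FramedGaloisRep ℚ ℚ_[2] 4}
    (hframe : A.IsFrameOfTateRep 2 c r) {q : ℕ} (hq : q.Prime) (hq2 : q ≠ 2) {a b : ℤ}
    (hL : A.HasGoodEulerFactorAt q ((lPolynomialOfSurface q a b).map (Int.castRingHom ℚ)))
    (ha : Odd a) (hb : Odd b) :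
    ∃ σ : absoluteGaloisGroup ℚ, perm σ ^ 5 = 1 ∧ perm σ ≠ 1 := by
  obtain ⟨v, 𝔓, h𝔓, σ, hv, hσ⟩ := exists_arithFrob q hq
  have hc := charpoly_s5bMatrix_perm_frob hA he hframe hq2 (hq.odd_of_ne_two hq2) hL hv h𝔓 hσ
  rw [(ZMod.intCast_eq_one_iff_odd).2 ha, (ZMod.intCast_eq_one_iff_odd).2 hb, map_one, one_mul,
    one_mul, one_mul] at hc
  obtain ⟨h5, h1⟩ := pow_five_eq_one_of_charpoly_eq hc
  refine ⟨σ, eq_one_of_s5bMatrix_eq_one _ (by rw [s5bMatrix_pow, h5]), fun h => h1 ?_⟩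
  rw [h, s5bMatrix_one]

/-- **GAL5, the `3`-part, from an Euler factor**: `a_q` odd, `b_q` even at a good odd prime `q` ⟹ some
`σ ∈ Γ_ℚ` (a Frobenius at `q`) acts on the five non-rational Weierstrass points by an element of order
`3` or `6` (cycle type `(3)` or `(3,2)`): `(perm σ)⁶ = 1`, `(perm σ)² ≠ 1`. [cite: BoxerCalegariGeePilloni2025, §8.1] [cite: BrumerEtAl2019, (5.2.3) p. 1175] -/
theorem exists_perm_pow_six_of_eulerData (hA : A.dim = 2)
    (he : ∀ (g : absoluteGaloisGroup ℚ) (P : A.geomTorsion (2 : ℕ)), e (g • P) = s5bMatrix (perm g) *ᵥ e P)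
    {c : Module.Basis (Fin 4) ℚ_[2] (A.rationalTateModule 2)} {r : FramedGaloisRep ℚ ℚ_[2] 4}
    (hframe : A.IsFrameOfTateRep 2 c r) {q : ℕ} (hq : q.Prime) (hq2 : q ≠ 2) {a b : ℤ}
    (hL : A.HasGoodEulerFactorAt q ((lPolynomialOfSurface q a b).map (Int.castRingHom ℚ)))
    (ha : Odd a) (hb : Even b) :
    ∃ σ : absoluteGaloisGroup ℚ, perm σ ^ 6 = 1 ∧ perm σ ^ 2 ≠ 1 := by
  obtain ⟨v, 𝔓, h𝔓, σ, hv, hσ⟩ := exists_arithFrob q hq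
  have hc := charpoly_s5bMatrix_perm_frob hA he hframe hq2 (hq.odd_of_ne_two hq2) hL hv h𝔓 hσ
  rw [(ZMod.intCast_eq_one_iff_odd).2 ha, (ZMod.intCast_zmod_eq_zero_iff_dvd b 2).2 (even_iff_two_dvd.1 hb),
    map_one, map_zero, one_mul, one_mul, zero_mul, add_zero] at hc
  obtain ⟨h6, h2⟩ := pow_six_eq_one_of_charpoly_eq hc
  refine ⟨σ, eq_one_of_s5bMatrix_eq_one _ (by rw [s5bMatrix_pow, h6]), fun h => h2 ?_⟩
  rw [← s5bMatrix_pow, h, s5bMatrix_one]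

end Frame

end Summit.Ventures.ResidMod

end
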